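import Mathlib

/-!
# Stub `stub_splitBound` of line `crossing-split-integrability`
(crux `Summit.QuantumFields.QCD.Theses.PauliWegnerSea.PhaseQuenchedFlavourDecay` =
`Summit.QuantumFields.QCD.Theses.WilsonMobilityGap.PhaseQuenchedFlavourDecay`,
item stmt-QuantumFields-9151)

A pure probability lemma: splitting `∫ X` on the event `{η < G}` and bounding the two pieces by
two Hölder inequalities, the second one after the interpolation `X ≤ X^{1-α} (η^q Y)^α` with
`α = ε / (1 + 2ε)` on the complementary event `{G ≤ η}`.
-/

noncomputable section

namespace Summit.QuantumFields.QCD.Cruxes.PhaseQuenchedFlavourDecay.CrossingSplitIntegrability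

open scoped BigOperators
open MeasureTheory Filter

/-- A nonnegative measurable real function whose `p`-th power (`0 < p`) is integrable lies in
`L^p`. -/
private theorem memLp_of_integrable_rpow {Ω : Type} [MeasurableSpace Ω] {ν : Measure Ω}
    {p : ℝ} (hp : 0 < p) {f : Ω → ℝ} (hf0 : ∀ ω, 0 ≤ f ω) (hfm : Measurable f)
    (hf : Integrable (fun ω => f ω ^ p) ν) : MemLp f (ENNReal.ofReal p) ν := by
  have h0 : ENNReal.ofReal p ≠ 0 := (ENNReal.ofReal_pos.mpr hp).ne'
  rw [← integrable_norm_rpow_iff hfm.aestronglyMeasurable h0 ENNReal.ofReal_ne_top,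
    ENNReal.toReal_ofReal hp.le]
  refine hf.congr (Eventually.of_forall fun ω => ?_)
  simp only [Real.norm_of_nonneg (hf0 ω)]

/-- Hölder's inequality for two nonnegative measurable real functions, with the `L^p` / `L^q`
hypotheses phrased as integrability of the `p`-th and `q`-th powers; it also records the
integrability of the product. -/
private theorem holder_of_integrable_rpow {Ω : Type} [MeasurableSpace Ω] {ν : Measure Ω}
    {p q : ℝ} (hpq : p.HolderConjugate q) {f g : Ω → ℝ}
    (hf0 : ∀ ω, 0 ≤ f ω) (hg0 : ∀ ω, 0 ≤ g ω) (hfm : Measurable f) (hgm : Measurable g)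
    (hf : Integrable (fun ω => f ω ^ p) ν) (hg : Integrable (fun ω => g ω ^ q) ν) :
    Integrable (fun ω => f ω * g ω) ν ∧
      ∫ ω, f ω * g ω ∂ν ≤
        (∫ ω, f ω ^ p ∂ν) ^ (1 / p) * (∫ ω, g ω ^ q ∂ν) ^ (1 / q) := by
  have hfp : MemLp f (ENNReal.ofReal p) ν := memLp_of_integrable_rpow hpq.pos hf0 hfm hf
  have hgq : MemLp g (ENNReal.ofReal q) ν := memLp_of_integrable_rpow hpq.symm.pos hg0 hgm hg
  refine ⟨?_, integral_mul_le_Lp_mul_Lq_of_nonneg hpq (Eventually.of_forall hf0)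
    (Eventually.of_forall hg0) hfp hgq⟩
  have hinst : ENNReal.HolderTriple (ENNReal.ofReal p) (ENNReal.ofReal q) 1 :=
    ENNReal.holderConjugate_iff.mpr hpq.inv_add_inv_ennreal
  exact memLp_one_iff_integrable.mp (MemLp.mul' (hpqr := hinst) hgq hfp)

/-- Registered stub `stub_splitBound` of line `crossing-split-integrability` for crux
stmt-QuantumFields-9151: splitting `∫ X` on `{η < G}`; Hölder with exponents `(1+ε, (1+ε)/ε)`
on the event and, after the interpolation `X ≤ X^{1-α} (η^q Y)^α` (`α = ε/(1+2ε)`), Hölder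
with exponents `((1+2ε)/(2ε), 1+2ε)` off it. -/
theorem stub_splitBound :
    ∀ (Ω : Type) [MeasurableSpace Ω] (ν : Measure Ω) [IsProbabilityMeasure ν] (X Y G : Ω → ℝ) (ε η : ℝ) (q : ℕ),
      0 < ε → 0 < η → η ≤ 1 → (∀ ω, 0 ≤ X ω) → (∀ ω, 0 ≤ Y ω) → Measurable X → Measurable Y → Measurable G →
      Integrable (fun ω => X ω ^ (1 + ε)) ν → Integrable (fun ω => Real.sqrt (Y ω)) ν →
      (∀ ω, G ω ≤ η → X ω ≤ η ^ q * Y ω) →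
        ∫ ω, X ω ∂ν ≤
          (∫ ω, X ω ^ (1 + ε) ∂ν) ^ (1 / (1 + ε)) * (ν {ω | η < G ω}).toReal ^ (ε / (1 + ε)) +
            η ^ ((q : ℝ) * ε / (1 + 2 * ε)) * (∫ ω, Real.sqrt (Y ω) ∂ν) ^ (2 * ε / (1 + 2 * ε)) *
              (∫ ω, X ω ^ (1 + ε) ∂ν) ^ (1 / (1 + 2 * ε)) := by
  intro Ω _ ν _ X Y G ε η q hε hη _hη1 hX0 hY0 hXm hYm hGm hXint hYint hdom
  -- the splitting event
  set A : Set Ω := {ω | η < G ω} with hA_def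
  have hA : MeasurableSet A := measurableSet_lt measurable_const hGm
  -- the auxiliary exponents `α = ε/(1+2ε)` and `P = (1+2ε)/(2ε)`
  obtain ⟨α, hα⟩ : ∃ α : ℝ, α = ε / (1 + 2 * ε) := ⟨_, rfl⟩
  obtain ⟨P, hP⟩ : ∃ P : ℝ, P = (1 + 2 * ε) / (2 * ε) := ⟨_, rfl⟩
  have hε2 : 0 < 1 + 2 * ε := by linarith
  have hα0 : 0 < α := by rw [hα]; positivity
  have hαP : α * P = 1 / 2 := by
    rw [hα, hP, div_mul_div_comm, div_eq_div_iff (by positivity) two_ne_zero]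
    ring
  have hαP' : (1 - α) * (1 + 2 * ε) = 1 + ε := by
    rw [hα, sub_mul, one_mul, div_mul_cancel₀ _ hε2.ne']
    ring
  have hPinv : 1 / P = 2 * ε / (1 + 2 * ε) := by rw [hP, one_div_div]
  have hpq1 : (1 + ε).HolderConjugate ((1 + ε) / ε) := by
    refine ⟨?_, by linarith, by positivity⟩
    rw [inv_one, inv_div, inv_eq_one_div, ← add_div]
    exact div_self (by linarith)
  have hpq2 : P.HolderConjugate (1 + 2 * ε) := by
    refine ⟨?_, by rw [hP]; positivity, hε2⟩
    rw [hP, inv_one, inv_div, inv_eq_one_div, ← add_div, div_eq_one_iff_eq hε2.ne']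
    ring
  -- the constant in front of the second term
  set C : ℝ := η ^ ((q : ℝ) * ε / (1 + 2 * ε)) with hC_def
  have hC0 : 0 ≤ C := Real.rpow_nonneg hη.le _
  have hCq : (η ^ q) ^ α = C := by
    rw [hC_def, ← Real.rpow_natCast, ← Real.rpow_mul hη.le, hα, mul_div_assoc]
  -- the indicator of `A`
  obtain ⟨gA, hgA⟩ : ∃ g : Ω → ℝ, g = A.indicator (fun _ => (1 : ℝ)) := ⟨_, rfl⟩
  have hgA_m : Measurable gA := by rw [hgA]; exact measurable_const.indicator hA
  have hgA0 : ∀ ω, 0 ≤ gA ω := fun ω => by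
    rw [hgA]; exact Set.indicator_nonneg (fun _ _ => zero_le_one) ω
  have hgA_pow : ∀ ω, gA ω ^ ((1 + ε) / ε) = gA ω := by
    intro ω
    rw [hgA]
    by_cases hω : ω ∈ A
    · simp only [Set.indicator_of_mem hω, Real.one_rpow]
    · simp only [Set.indicator_of_notMem hω, Real.zero_rpow (by positivity : (1 + ε) / ε ≠ 0)]
  -- pointwise power identities
  have hYpow : ∀ ω, (Y ω ^ α) ^ P = Real.sqrt (Y ω) := fun ω => by
    rw [← Real.rpow_mul (hY0 ω), hαP, Real.sqrt_eq_rpow]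
  have hXpow : ∀ ω, (X ω ^ (1 - α)) ^ (1 + 2 * ε) = X ω ^ (1 + ε) := fun ω => by
    rw [← Real.rpow_mul (hX0 ω), hαP']
  -- integrability of the relevant powers
  have hgA_int : Integrable (fun ω => gA ω ^ ((1 + ε) / ε)) ν := by
    simp_rw [hgA_pow]
    rw [hgA]
    exact (integrable_const (1 : ℝ)).indicator hA
  have hYa_int : Integrable (fun ω => (Y ω ^ α) ^ P) ν := by
    simp_rw [hYpow]; exact hYint
  have hXa_int : Integrable (fun ω => (X ω ^ (1 - α)) ^ (1 + 2 * ε)) ν := by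
    simp_rw [hXpow]; exact hXint
  -- the two Hölder inequalities
  obtain ⟨hXg_int, hXg_le⟩ :
      Integrable (fun ω => X ω * gA ω) ν ∧
        ∫ ω, X ω * gA ω ∂ν ≤
          (∫ ω, X ω ^ (1 + ε) ∂ν) ^ (1 / (1 + ε)) *
            (∫ ω, gA ω ^ ((1 + ε) / ε) ∂ν) ^ (1 / ((1 + ε) / ε)) :=
    holder_of_integrable_rpow hpq1 hX0 hgA0 hXm hgA_m hXint hgA_int
  obtain ⟨hYX_int, hYX_le⟩ :
      Integrable (fun ω => Y ω ^ α * X ω ^ (1 - α)) ν ∧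
        ∫ ω, Y ω ^ α * X ω ^ (1 - α) ∂ν ≤
          (∫ ω, (Y ω ^ α) ^ P ∂ν) ^ (1 / P) *
            (∫ ω, (X ω ^ (1 - α)) ^ (1 + 2 * ε) ∂ν) ^ (1 / (1 + 2 * ε)) :=
    holder_of_integrable_rpow hpq2 (fun ω => Real.rpow_nonneg (hY0 ω) α)
      (fun ω => Real.rpow_nonneg (hX0 ω) (1 - α)) (hYm.pow_const α) (hXm.pow_const (1 - α))
      hYa_int hXa_int
  -- evaluation of the integrals appearing in the Hölder bounds
  have hI1 : ∫ ω, gA ω ^ ((1 + ε) / ε) ∂ν = (ν A).toReal := by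
    simp_rw [hgA_pow]
    rw [hgA, integral_indicator_const _ hA, smul_eq_mul, mul_one, measureReal_def]
  have hI2 : ∫ ω, (Y ω ^ α) ^ P ∂ν = ∫ ω, Real.sqrt (Y ω) ∂ν := by simp_rw [hYpow]
  have hI3 : ∫ ω, (X ω ^ (1 - α)) ^ (1 + 2 * ε) ∂ν = ∫ ω, X ω ^ (1 + ε) ∂ν := by
    simp_rw [hXpow]
  rw [hI1, one_div_div] at hXg_le
  rw [hI2, hI3, hPinv] at hYX_le
  -- the pointwise splitting bound
  have hpt : ∀ ω, X ω ≤ X ω * gA ω + C * (Y ω ^ α * X ω ^ (1 - α)) := by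
    intro ω
    have hprod0 : 0 ≤ C * (Y ω ^ α * X ω ^ (1 - α)) :=
      mul_nonneg hC0 (mul_nonneg (Real.rpow_nonneg (hY0 ω) _) (Real.rpow_nonneg (hX0 ω) _))
    by_cases hω : ω ∈ A
    · have hg1 : gA ω = 1 := by rw [hgA]; exact Set.indicator_of_mem hω _
      rw [hg1, mul_one]
      linarith
    · have hg0 : gA ω = 0 := by rw [hgA]; exact Set.indicator_of_notMem hω _
      have hGω : G ω ≤ η := by
        rw [hA_def] at hω
        simpa using hω
      have hXle : X ω ≤ η ^ q * Y ω := hdom ω hGω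
      have hXsplit : X ω = X ω ^ α * X ω ^ (1 - α) := by
        rw [← Real.rpow_add' (hX0 ω) (by rw [add_sub_cancel]; exact one_ne_zero), add_sub_cancel,
          Real.rpow_one]
      rw [hg0, mul_zero, zero_add]
      calc X ω = X ω ^ α * X ω ^ (1 - α) := hXsplit
        _ ≤ (η ^ q * Y ω) ^ α * X ω ^ (1 - α) :=
          mul_le_mul_of_nonneg_right (Real.rpow_le_rpow (hX0 ω) hXle hα0.le)
            (Real.rpow_nonneg (hX0 ω) _)
        _ = C * (Y ω ^ α * X ω ^ (1 - α)) := by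
          rw [Real.mul_rpow (pow_nonneg hη.le q) (hY0 ω), hCq]
          ring
  -- integrate the pointwise bound
  have hmain : ∫ ω, X ω ∂ν ≤
      ∫ ω, X ω * gA ω ∂ν + C * ∫ ω, Y ω ^ α * X ω ^ (1 - α) ∂ν := by
    have hint_rhs : Integrable (fun ω => X ω * gA ω + C * (Y ω ^ α * X ω ^ (1 - α))) ν :=
      hXg_int.add (hYX_int.const_mul C)
    have h :=
      integral_mono_of_nonneg (Eventually.of_forall hX0) hint_rhs (Eventually.of_forall hpt)
    rwa [integral_add hXg_int (hYX_int.const_mul C), integral_const_mul] at h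
  calc ∫ ω, X ω ∂ν
      ≤ ∫ ω, X ω * gA ω ∂ν + C * ∫ ω, Y ω ^ α * X ω ^ (1 - α) ∂ν := hmain
    _ ≤ (∫ ω, X ω ^ (1 + ε) ∂ν) ^ (1 / (1 + ε)) * (ν A).toReal ^ (ε / (1 + ε)) +
          C * ((∫ ω, Real.sqrt (Y ω) ∂ν) ^ (2 * ε / (1 + 2 * ε)) *
            (∫ ω, X ω ^ (1 + ε) ∂ν) ^ (1 / (1 + 2 * ε))) :=
      add_le_add hXg_le (mul_le_mul_of_nonneg_left hYX_le hC0)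
    _ = (∫ ω, X ω ^ (1 + ε) ∂ν) ^ (1 / (1 + ε)) * (ν A).toReal ^ (ε / (1 + ε)) +
          C * (∫ ω, Real.sqrt (Y ω) ∂ν) ^ (2 * ε / (1 + 2 * ε)) *
            (∫ ω, X ω ^ (1 + ε) ∂ν) ^ (1 / (1 + 2 * ε)) := by ring

end Summit.QuantumFields.QCD.Cruxes.PhaseQuenchedFlavourDecay.CrossingSplitIntegrability

end
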